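import Summits.CriticalPhenomena.PercolationContinuityZ3.Theorems.Transplant.SkelWinChainT
import Summits.CriticalPhenomena.PercolationContinuityZ3.Theorems.Transplant.KNCells2CorridorEdge
import Summits.CriticalPhenomena.PercolationContinuityZ3.Theorems.Transplant.KNCells2Face
import HarnessLib

/-!
# L6.0b — THE TWO PACKAGING THEOREMS over a `PlanarSkeletonConc`: `hreach` from a WINDOW CORRIDOR CHAIN and `cond_j` (`hface_j`) from ONE
# WINDOW STEP, for any lag-1 anchored scheme `S : KSchA V A` on `G` (generic twin of p2's `KNCells2TubePackaging`: `hreach_of_tubeChain` /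
# `cond_of_tubeStep`, with `tubeGraph X π ↦ Skel.winGraph G root Rπ` and the records of `SkelWinChainT`)

builds on p205010 (kernel theorem, internal audit signed; external expert review pending) — nothing in this file uses p205010.
Status sentence (coordinator 2026-08-20T04:30Z): "θ(p_c) = 0 on ℤ^d, all d ≥ 2 — kernel-verified (Lean 4/Mathlib, standard axioms); internal adversarial
audit SIGNED 2026-08-20 04:29Z; external expert review pending."
Lane `prim-bschramm-*`, seat `prim-bschramm-stmt` (gen 7; port handed over by p2-g3 19:13:45Z); helper file (`--supports stmt-CriticalPhenomena-4575`).
The generic cores `KSchA.hreach_of_chain_edge_sub` (KNCells2CorridorEdge) and `KSchA.cond_of_step` (KNCells2Face) are over an arbitrary finite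
chain graph `G'` on the vertex type already; here `G' := Skel.winGraph G P.root P.Rπ` and the steps are `WinChainData.stepE` / `WinStepData.tstep`.
Differences from the product, all forced by `π ↦ Rπ`: the arrival cube hypothesis reads `M^{α}_x ⊆ Win root (C.M x) R₀` with `R₀ ≤ Rπ`
(product: `⊆ π' × C.M x`, `π' ⊆ π`), the last-target hypothesis reads `Win root (C.M y ∩ H_{x,y}) Rπ ⊆ M^{a'}_y` (one unit of depth at the
consumer, since scheme regions are vertex spans), and the nonemptiness of the true targets is a hypothesis (`hTne`; from (ι) `step` at the consumer).
* **`Skel.hreach_of_winChain`** — after a valid history, the chain property for the window graph (stmt's `Φ.chain_edge_UP` at `G' = winGraph …`),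
  per step the kit clause + subbox + support facts + the rim excess `P_{Wcor}(root ↔ Rim_i) ≤ η ≤ δ/2`, the arrival cube inside `X^{(0)}_0` and the
  last true target inside `M^{a'}_{x+du}` give `1 - ε'' < P_{Wfull}(Reach h e (aOf₁) a' du)`;
* **`Skel.cond_of_winStep`** — one window step whose first level contains the face `F^{j+1}`, true target `T' ⊆ M^{a'}_{x+du}` inside the
  enlarged target, excess `≤ η ≤ δc/2`, turns `1 - δ₂ < P_{Wt}(root ↔ F^{j+1})` into `cond`.
[cite: KozmaNitzan2024, §4 p. 30 (Steps III–IV), Lemma 10 (p. 17), Lemma 12 (pp. 23–25)]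
-/

noncomputable section

open MeasureTheory ProbabilityTheory
open scoped ENNReal Classical

namespace Summit.CriticalPhenomena.PercolationContinuityZ3.Theorems

namespace Transplant

namespace Skel

open Literature.Probability.Percolation Literature.Probability.LatticeModels SimpleGraph KNCells
open GadgetSystem ProbeHistory HSiteScheme Contour

variable {V : Type} [DecidableEq V] [Countable V] {G : SimpleGraph V} [G.LocallyFinite] (Φ : PlanarSkeletonConc G)
variable {A : Type*} {S : KSchA V A} {FD : FaceData V A}
variable {h : ProbeHistory V} {e : Site 2 × MDir} {a a' : A} {du : MDir}

/-- **`hreach` FROM A WINDOW CORRIDOR CHAIN** (generic design (D)). [cite: KozmaNitzan2024, §4 Lemma 12 (pp. 23–25), p. 30 (Step IV)] -/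
theorem hreach_of_winChain (P : WinChainData V) (hV : S.Valid₂ G h e) {Δ' : ℕ} {δ ε'' η : ℝ}
    (hδc : S.δc ≤ δ)
    (hchain : ∀ (Wg : Sym2 V → unitInterval) (s : Fin (ChainPlanar.Sched.nLast + 1) → KNLevels.TStep (winGraph G P.root P.Rπ))
      (T' : Fin (ChainPlanar.Sched.nLast + 1) → Finset V) (η : ℝ),
      (∀ i, (s i).L.o = (s 0).L.o) →
      (∀ i : Fin ChainPlanar.Sched.nLast, T' (Fin.castSucc i) ⊆ (s i.succ).L.X 0) →
      (∀ i, T' i ⊆ (s i).T) →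
      (∀ i, (s i).KitsAt Wg S.p Δ' δ) →
      η ≤ δ / 2 →
      (∀ i, (prodBernoulli Wg).real (⋃ t ∈ (s i).T \ T' i, openConn (s 0).L.o t) ≤ η) →
      1 - δ < (prodBernoulli Wg).real (s 0).L.reachB →
        1 - ε'' < (prodBernoulli Wg).real (⋃ t ∈ T' (Fin.last ChainPlanar.Sched.nLast), openConn (s 0).L.o t))
    (hroot : P.root = S.Γ.root)
    (hr : P.C.r = 4 * P.t) (hR : 100 * P.R' ≤ P.t) (hRl : P.Rlev + 1 ≤ P.R') (hRim : ∀ i, P.Rim i ⊆ P.stepD Φ i)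
    (hTne : ∀ i ≤ ChainPlanar.Sched.nLast, (P.tgtT Φ i).Nonempty)
    (hj : P.j₁ ≤ P.Rlev) (hcount : 1 / (1 - (S.p : ℝ)) ^ (Δ' * P.N) ≤ δ * ((Finset.Icc P.j₀ P.j₁).card : ℝ))
    (hsub : ∀ i ≤ ChainPlanar.Sched.nLast,
      KNLevels.IsSubbox (winGraph G P.root P.Rπ) (S.Wcor G FD h e (S.aOf₁ G h e) a' du) S.p (P.stepD Φ i))
    (hfin : KNLevels.FinSupp (S.Wcor G FD h e (S.aOf₁ G h e) a' du) P.Sfin)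
    (hDS : ∀ i ≤ ChainPlanar.Sched.nLast, P.stepD Φ i ⊆ P.Sfin) (ho : ∀ i ≤ ChainPlanar.Sched.nLast, P.root ∉ P.stepD Φ i)
    (hoS : P.root ∈ P.Sfin)
    (hkits : ∀ i ≤ ChainPlanar.Sched.nLast, ∀ j ∈ Finset.Icc P.j₀ P.j₁,
      ∃ (σ : KNLevels.SData V) (Sz : Finset V),
      KNLevels.SHyp (winLData Φ P.root P.Rπ (P.lo i) (P.hi i) P.root P.Sfin) j σ ∧ σ.N ≤ P.N ∧
      (1 - (S.p : ℝ) ^ σ.sB) ^ σ.k ≤ δ ∧ Sz ⊆ (winLData Φ P.root P.Rπ (P.lo i) (P.hi i) P.root P.Sfin).X j ∧ Sz ⊆ P.stepD Φ i ∧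
      (∀ x ∈ σ.K, ∀ e' ∈ σ.seed x, e' ∉ wireSet (↑Sz : Set V)) ∧ (∀ x ∈ σ.K, σ.face x ⊆ Sz) ∧
      (∀ x ∈ σ.K, 1 - 3 * δ ≤ (prodBernoulli (S.Wcor G FD h e (S.aOf₁ G h e) a' du)).real {ω | ∃ u ∈ σ.face x,
        1 - δ < (prodBernoulli (pinW (S.Wcor G FD h e (S.aOf₁ G h e) a' du) (wireSet (↑Sz : Set V)) ω)).real
          (⋃ t ∈ P.tgtE Φ i, openConnIn (↑(P.stepD Φ i) : Set V) u t)}))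
    (hη : η ≤ δ / 2)
    (hexc : ∀ i ≤ ChainPlanar.Sched.nLast, (prodBernoulli (S.Wcor G FD h e (S.aOf₁ G h e) a' du)).real
      (⋃ t ∈ P.Rim i, openConn S.Γ.root t) ≤ η)
    {R₀ : ℕ} (hR₀ : R₀ ≤ P.Rπ) (hM0 : S.Γ.M (S.aOf₁ G h e) (tgt e) ⊆ Φ.Win P.root (P.C.M P.x) R₀)
    (hMn : Φ.Win P.root (P.C.M (P.x + stepVec P.du) ∩ P.C.Hfull P.x P.du) P.Rπ ⊆ S.Γ.M a' (tgt e + stepVec du)) :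
    1 - ε'' < (prodBernoulli (S.Wfull G h e (S.aOf₁ G h e) a' du)).real (S.Reach G FD h e (S.aOf₁ G h e) a' du) := by
  -- the chain as `Fin (nLast + 1)`-indexed target steps
  let s : Fin (ChainPlanar.Sched.nLast + 1) → KNLevels.TStep (winGraph G P.root P.Rπ) := fun i => P.stepE Φ i
  let T' : Fin (ChainPlanar.Sched.nLast + 1) → Finset V := fun i => P.tgtT Φ i
  have hle : ∀ i : Fin (ChainPlanar.Sched.nLast + 1), (i : ℕ) ≤ ChainPlanar.Sched.nLast := fun i => Nat.lt_succ_iff.1 i.2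
  refine KSchA.hreach_of_chain_edge_sub (winGraph G P.root P.Rπ) hV hδc hchain s T' (fun i => ?_) (fun i => ?_) (fun i => ?_)
    (fun i => ?_) hη (fun i => ?_) ?_ ?_
  · show (P.stepE Φ i).L.o = S.Γ.root
    rw [WinChainData.stepE_o, hroot]
  · show P.tgtT Φ (Fin.castSucc i) ⊆ (P.stepE Φ i.succ).L.X 0
    have : ((i.succ : Fin (ChainPlanar.Sched.nLast + 1)) : ℕ) = (Fin.castSucc i : ℕ) + 1 := by simp
    rw [show P.stepE Φ (i.succ : ℕ) = P.stepE Φ ((Fin.castSucc i : ℕ) + 1) by rw [this]]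
    exact P.tgtT_subset_X_zero_succ Φ _
  · exact P.tgtT_subset_tgtE Φ i
  · exact WinChainData.kitsAt_stepE Φ hR hRl hRim (hle i) (hTne i (hle i)) (hsub i (hle i)) hfin (hDS i (hle i)) (ho i (hle i)) hoS hj
      hcount (hkits i (hle i))
  · refine le_trans (measureReal_mono ?_ (measure_ne_top _ _)) (hexc i (hle i))
    intro ω hω
    simp only [Set.mem_iUnion, exists_prop] at hω ⊢
    obtain ⟨t, ht, hωt⟩ := hω
    exact ⟨t, P.tgtE_sdiff_subset Φ i ht, hωt⟩
  · -- the arrival cube lies in the first core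
    show S.Γ.M (S.aOf₁ G h e) (tgt e) ⊆ (P.stepE Φ ((0 : Fin (ChainPlanar.Sched.nLast + 1)) : ℕ)).L.X 0
    exact hM0.trans (WinChainData.cube_subset_X_zero Φ hr hR hR₀)
  · -- the last true target lies in `M_{x+du}`
    show P.tgtT Φ ((Fin.last ChainPlanar.Sched.nLast : Fin _) : ℕ) ⊆ S.Γ.M a' (tgt e + stepVec du)
    rw [Fin.val_last]
    exact (WinChainData.tgtT_last_subset Φ hr hR).trans hMn

omit [Countable V] in
/-- **`cond_j` FROM ONE WINDOW STEP** (generic design (D): the face input). [cite: KozmaNitzan2024, §4 p. 30 (Step III), Lemma 10 (p. 17)] -/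
theorem cond_of_winStep (P : WinStepData V) {j : ℕ} {o : Finset (Sym2 V)} {Δ' : ℕ} {δ₂ η : ℝ}
    (hstep : ∀ (Wg : Sym2 V → unitInterval) (s : KNLevels.TStep (winGraph G P.root P.Rπ)), s.KitsAt Wg S.p Δ' δ₂ →
      1 - δ₂ < (prodBernoulli Wg).real s.L.reachB → 1 - S.δc / 2 < (prodBernoulli Wg).real (⋃ t ∈ s.T, openConn s.L.o t))
    (hroot : P.root = S.Γ.root)
    (hsub : KNLevels.IsSubbox (winGraph G P.root P.Rπ) (S.Wt G h e a a' du j o) S.p (P.Rg Φ))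
    (hfin : KNLevels.FinSupp (S.Wt G h e a a' du j o) P.Sfin) (hDS : P.Rg Φ ⊆ P.Sfin)
    (hencl : Finset.Icc (P.lo - ((P.Rlev + 1 : ℕ) : Site 2)) (P.hi + ((P.Rlev + 1 : ℕ) : Site 2)) ⊆ P.Dpl)
    (ho : P.root ∉ P.Rg Φ) (hoS : P.root ∈ P.Sfin) (hj : P.j₁ ≤ P.Rlev) (hTD : P.T ⊆ P.Rg Φ) (hTne : P.T.Nonempty)
    (hcount : 1 / (1 - (S.p : ℝ)) ^ (Δ' * P.N) ≤ δ₂ * ((Finset.Icc P.j₀ P.j₁).card : ℝ))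
    (hkits : ∀ j' ∈ Finset.Icc P.j₀ P.j₁, ∃ (σ : KNLevels.SData V) (Sz : Finset V),
      KNLevels.SHyp (winLData Φ P.root P.Rπ P.lo P.hi P.root P.Sfin) j' σ ∧ σ.N ≤ P.N ∧
      (1 - (S.p : ℝ) ^ σ.sB) ^ σ.k ≤ δ₂ ∧ Sz ⊆ (winLData Φ P.root P.Rπ P.lo P.hi P.root P.Sfin).X j' ∧ Sz ⊆ P.Rg Φ ∧
      (∀ x ∈ σ.K, ∀ e' ∈ σ.seed x, e' ∉ wireSet (↑Sz : Set V)) ∧ (∀ x ∈ σ.K, σ.face x ⊆ Sz) ∧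
      (∀ x ∈ σ.K, 1 - 3 * δ₂ ≤ (prodBernoulli (S.Wt G h e a a' du j o)).real {ω | ∃ u ∈ σ.face x,
        1 - δ₂ < (prodBernoulli (pinW (S.Wt G h e a a' du j o) (wireSet (↑Sz : Set V)) ω)).real
          (⋃ t ∈ P.T, openConnIn (↑(P.Rg Φ) : Set V) u t)}))
    (T' : Finset V) (hT' : T' ⊆ P.T) (hT'M : T' ⊆ S.Γ.M a' (tgt e + stepVec du))
    (hexc : (prodBernoulli (S.Wt G h e a a' du j o)).real (⋃ t ∈ P.T \ T', openConn S.Γ.root t) ≤ η) (hη : η ≤ S.δc / 2)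
    (hface : FD.Face a' (tgt e) du (j + 1) ⊆ (P.Lv Φ).X 0)
    (hsrc : 1 - δ₂ < (prodBernoulli (S.Wt G h e a a' du j o)).real
      (⋃ b ∈ FD.Face a' (tgt e) du (j + 1), openConn S.Γ.root b)) :
    S.cond G h e a a' du j o :=
  KSchA.cond_of_step (winGraph G P.root P.Rπ) hstep (P.tstep Φ) (by rw [WinStepData.tstep_o, hroot])
    (WinStepData.kitsAt_tstep Φ hsub hfin hDS hencl ho hoS hj hTD hTne hcount hkits) T' hT' hT'M hexc hη hface hsrc

end Skel

end Transplant

end Summit.CriticalPhenomena.PercolationContinuityZ3.Theorems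

end
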